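import Literature.MathematicalPhysics.QuantumFieldTheory.Balaban1983to89.B9Eq319BlockTentLift

/-!
# `Balaban1983to89.B9Eq3126BondTentProfile` — T. Bałaban, *Propagators for lattice gauge theories in a background field*, Commun. Math. Phys. **99**
# (1985) 389–434 [Balaban1985BackgroundPropagators] (3.126) p. 420 `HB = GQ*(QGQ*)⁻¹B` with Thm 3.11 p. 416 and (3.15) p. 393, and [Balaban1985Averaging]
# (125) p. 36: **THE SKEWED ONE-COORDINATE PROFILE `q(k) = k²(L−1−k)` OF THE BOND TEST FIELD FOR THE LOWER BOUND OF `QG₁Q*` AT THE FLAT ONE-STEP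
# VECTOR AVERAGING — its sums against the sweep counts `k+1` ∕ `L−1−k`, the margin `Σ(2k+2−L)q(k) ≥ L(L−1)²(L−2)²∕60`, step and size bounds** —
# the arithmetic kit of the pub-balaban NE9 chain's variational `H₁`-currency (`B9Eq3126GreenLettersVariational`)

statement-level skeleton of published theorems with citation tags; proofs where landed; nothing here is a claim about the Yang–Mills mass gap

CITATION HEADER (lean-in-tree rule).  Audit cell `pub-balaban`, sub-cell `t4`, BINDER row NE9; filed by NE9 formalisation-swarm LEAF PROVER 02
(`b2b-balaban-t4-ne9-formalise-leaf-02`, gen 65).  Sources READ in the held text layers: [Balaban1985BackgroundPropagators]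
(`paper:balaban1985-cmp99-background-propagators`, journal page = PDF page + 388) p. 393 (3.15), p. 416 Thm 3.11, p. 420 (3.126); [Balaban1985Averaging]
(`paper:balaban1985-cmp98-averaging`, journal page = PDF page + 16) p. 36 (125) via the tree's `B7Prop3Flat.Q0form` ∕ `B9Eq315QFlatNorm.QtorusLin_one_apply`.

THE PRINT (verbatim).  [B7] (125) p. 36: *«(Q₀A)_c = Σ_{x∈B(c₋)} L^{−(d+1)} A([x, x′])»* (`x′ = x + Le_κ`) — at the flat background the one-step vector
averaging of a bond function at the coarse bond `c = ⟨y, y+e_κ⟩` is the mean over the `L^{d+1}` fine bonds swept by the straight segments `[x, x + Le_κ]`,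
`x ∈ B(y)` (tree: `B9Eq315QFlatNorm.QtorusLin_one_apply`, the frame cancellation `B7Prop3Flat.frame_cancellation`).  [B9] p. 416, Thm 3.11: *«the operators
Δ′_a, G′, (Q′G′²Q′*)⁻¹, Δ_a, G are positive definite»*; p. 420, (3.126): *«HB = GQ*(QGQ*)⁻¹B»*.

WHY THIS FILE (cell context).  The fine bond `⟨x + ke_κ, ·+e_κ⟩` of the block `B(y)` at depth `k` along `κ` is swept by `k+1` of the `L^{d+1}` segments
of the coarse bond `⟨y, y+e_κ⟩` and by `L−1−k` of those of `⟨y−e_κ, y⟩`.  A variational lower bound of `K = QG₁Q†` (the test-family floor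
`B9Eq3126GreenLettersVariational.re_inner_K_ge_of_test`) with ONE lifted test field per coarse bond therefore needs a depth profile whose `(k+1)`-weighted
sum beats its `(L−1−k)`-weighted sum by a margin of the SAME order `L⁵` (a profile symmetric about the block centre gives a margin `∝ L⁴` only — one power
of the block size short, i.e. level-dependent on print's diagonal).  The profile `q(k) = k²(L−1−k)` (vanishing on both faces, skewed to the far face) does:
`Σ(2k+2−L)q(k) = [L(L−1)²(L−2)² + 2L(L−1)(L−2)(3L−5)]∕60`.  This file is that arithmetic; the lift, its averaging and its Dirichlet forms are the
sequel's (`B9Eq3126BondTentLift`), on ne9-leaf-01's site kit `B9Eq319BlockTentLift` (profile `p(k) = k(L−1−k)`) used transversally.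

WHAT IS PROVED (sorry-free; 0 `def`; [folklore] elementary arithmetic; nothing of [B9]∕[B7] asserted).
* §1 THE PROFILE `q(k) = k²(L−1−k)`: `qprof_nonneg`, `qprof_le` (`≤ L³`), `abs_qprof_succ_sub_le` (`≤ 2L²` per step), `qprof_zero`, `qprof_last`.
* §2 THE SWEEP COUNTS: **`sum_sum_range_sub_eq`** (`Σ_{k<L}Σ_{i<L−k} f(k+i) = Σ_{n<L}(n+1)f(n)`), **`sum_sum_range_lt_eq`** (`Σ_{k<L}Σ_{t<k} f(t) = Σ_{n<L}(L−1−n)f(n)`).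
* §3 CLOSED FORMS: `twelve_mul_sum_sq_mul_sub` (`12Σ_{k<n}k²(c−k)`), `sixty_mul_sum_cube_mul_sub` (`60Σ_{k<n}k³(c−k)`), **`sum_qprof_eq`**
  (`Σ_{k<L} q(k) = L(L−1)²(L−2)∕12`), **`sixty_mul_sum_skew_qprof_eq`** (`60·Σ(2k+2−L)q(k) = L(L−1)²(L−2)² + 2L(L−1)(L−2)(3L−5)`),
  **`sum_skew_qprof_ge`** (`Σ(2k+2−L)q(k) ≥ L(L−1)²(L−2)²∕60`), `sum_succ_mul_qprof_add` (`Σ(k+1)q + Σ(L−1−k)q = L·Σq`).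
* §4 CRUDE POWER BOUNDS for `3 ≤ L`: `sum_profile_ge` (`Σ_{k<L}k(L−1−k) ≥ L³∕27`), `sum_qprof_le` (`Σq ≤ L⁴∕12`), **`sum_skew_qprof_ge_pow`**
  (`Σ(2k+2−L)q(k) ≥ L⁵∕1215`).
HONEST SCOPE.  Elementary; crude constants; NOT NE9, NOT the route (cell pub-balaban: NE9 NOT PRINTED ∕ NOT PROVED; «NE9 ⇐ the named binders»; spine PROVED 0∕9;
rung (B)+1 on a finite T⁴ — NOT infinite volume, NOT mass gap, NOT Clay).  HONEST DEPENDENCY (cell line): continuum YM on T⁴ ⇐ BetaPertH ∧ nine spine estimates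
(0/9 proved); BetaPertH ⇐ (D1) ∧ (D4) ∧ CAP+tail; G-an2-4 gates asym, D1 and NE2/3/4.  NEW file importing `B9Eq319BlockTentLift` (ne9-leaf-01 g78) only;
nothing modified.  Net new unproved facts: 0.
-/

noncomputable section

open scoped BigOperators

namespace Literature.MathematicalPhysics.QuantumFieldTheory.Balaban1983to89.B9Eq3126BondTentProfile

open B9Eq319BlockTentLift (sum_profile_eq profile_nonneg profile_le)

/-! ## §1 The skewed profile `q(k) = k²(L−1−k)` -/

/-- `0 ≤ k²(L−1−k)` for `k < L`. [folklore] [cite: Balaban1985Averaging, (125) p.36] -/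
theorem qprof_nonneg {L k : ℕ} (hk : k < L) : 0 ≤ (k : ℝ) ^ 2 * ((L : ℝ) - 1 - k) := by
  have h1 : (k : ℝ) + 1 ≤ L := by exact_mod_cast hk
  exact mul_nonneg (sq_nonneg _) (by linarith)

/-- `k²(L−1−k) ≤ L³` for `k < L`. [folklore] [cite: Balaban1985Averaging, (125) p.36] -/
theorem qprof_le {L k : ℕ} (hk : k < L) : (k : ℝ) ^ 2 * ((L : ℝ) - 1 - k) ≤ (L : ℝ) ^ 3 := by
  have h1 : (k : ℝ) + 1 ≤ L := by exact_mod_cast hk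
  have hk0 : (0 : ℝ) ≤ k := Nat.cast_nonneg k
  have h2 : (k : ℝ) ^ 2 ≤ (L : ℝ) ^ 2 := pow_le_pow_left₀ hk0 (by linarith) 2
  have h3 : (L : ℝ) - 1 - k ≤ L := by linarith
  calc (k : ℝ) ^ 2 * ((L : ℝ) - 1 - k) ≤ (L : ℝ) ^ 2 * L := mul_le_mul h2 h3 (by linarith) (sq_nonneg _)
    _ = (L : ℝ) ^ 3 := by ring

/-- the profile is `2L²`-Lipschitz per step inside a block: `|(k+1)²(L−2−k) − k²(L−1−k)| ≤ 2L²` for `k + 1 < L`. [folklore] [cite: Balaban1985Averaging, (125) p.36] -/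
theorem abs_qprof_succ_sub_le {L k : ℕ} (hk : k + 1 < L) :
    |((k : ℝ) + 1) ^ 2 * ((L : ℝ) - 1 - (k + 1)) - (k : ℝ) ^ 2 * ((L : ℝ) - 1 - k)| ≤ 2 * (L : ℝ) ^ 2 := by
  have h1 : (k : ℝ) + 2 ≤ L := by exact_mod_cast hk
  have hk0 : (0 : ℝ) ≤ k := Nat.cast_nonneg k
  have e : ((k : ℝ) + 1) ^ 2 * ((L : ℝ) - 1 - (k + 1)) - (k : ℝ) ^ 2 * ((L : ℝ) - 1 - k) =
      (2 * k + 1) * ((L : ℝ) - 2 - k) - (k : ℝ) ^ 2 := by ring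
  rw [e, abs_le]
  constructor <;> nlinarith

/-- the profile vanishes at the near face. [folklore] [cite: Balaban1985Averaging, (125) p.36] -/
theorem qprof_zero (L : ℕ) : ((0 : ℕ) : ℝ) ^ 2 * ((L : ℝ) - 1 - (0 : ℕ)) = 0 := by simp

/-- the profile vanishes at the far face `k = L − 1` (stated as `k + 1 = L`). [folklore] [cite: Balaban1985Averaging, (125) p.36] -/
theorem qprof_last {L k : ℕ} (hk : k + 1 = L) : (k : ℝ) ^ 2 * ((L : ℝ) - 1 - k) = 0 := by
  have : (L : ℝ) = k + 1 := by exact_mod_cast hk.symm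
  rw [this]; ring

/-! ## §2 The sweep counts: `k + 1` segments of the own coarse bond, `L − 1 − k` of the previous one -/

/-- **`Σ_{k<L} Σ_{i<L−k} f(k+i) = Σ_{n<L} (n+1)·f(n)`** — the fine bond at depth `n` of `B(y)` is swept by the segments starting at depths `k ≤ n`
of the SAME block (`n + 1` of them). [folklore] [cite: Balaban1985Averaging, (125) p.36; Balaban1985BackgroundPropagators, (3.15) p.393] -/
theorem sum_sum_range_sub_eq (f : ℕ → ℝ) :
    ∀ L : ℕ, ∑ k ∈ Finset.range L, ∑ i ∈ Finset.range (L - k), f (k + i) = ∑ n ∈ Finset.range L, ((n : ℝ) + 1) * f n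
  | 0 => by simp
  | L + 1 => by
    rw [Finset.sum_range_succ, Finset.sum_range_succ (fun n => ((n : ℝ) + 1) * f n), ← sum_sum_range_sub_eq f L,
      Nat.add_sub_cancel_left, Finset.sum_range_one, add_zero]
    have h : ∑ k ∈ Finset.range L, ∑ i ∈ Finset.range (L + 1 - k), f (k + i) =
        ∑ k ∈ Finset.range L, (∑ i ∈ Finset.range (L - k), f (k + i) + f L) := by
      refine Finset.sum_congr rfl fun k hk => ?_
      have hkL : k ≤ L := (Finset.mem_range.1 hk).le
      rw [Nat.succ_sub hkL, Finset.sum_range_succ, Nat.add_sub_cancel' hkL]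
    rw [h, Finset.sum_add_distrib, Finset.sum_const, Finset.card_range, nsmul_eq_mul]
    ring

/-- **`Σ_{k<L} Σ_{t<k} f(t) = Σ_{n<L} (L−1−n)·f(n)`** — the fine bond at depth `n` of `B(y)` is swept by the segments starting at depths `k > n` of the
PREVIOUS block (`L − 1 − n` of them; the segment from depth `k` reaches depths `0, …, k−1` of the next block). [folklore]
[cite: Balaban1985Averaging, (125) p.36; Balaban1985BackgroundPropagators, (3.15) p.393] -/
theorem sum_sum_range_lt_eq (f : ℕ → ℝ) :
    ∀ L : ℕ, ∑ k ∈ Finset.range L, ∑ t ∈ Finset.range k, f t = ∑ n ∈ Finset.range L, ((L : ℝ) - 1 - n) * f n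
  | 0 => by simp
  | L + 1 => by
    rw [Finset.sum_range_succ, sum_sum_range_lt_eq f L, Finset.sum_range_succ (fun n => (((L + 1 : ℕ) : ℝ) - 1 - n) * f n)]
    push_cast
    rw [show ((L : ℝ) + 1 - 1 - L) * f L = 0 by ring, add_zero, ← Finset.sum_add_distrib]
    exact Finset.sum_congr rfl fun n _ => by ring

/-! ## §3 Closed forms -/

/-- `12·Σ_{k<n} k²(c−k) = n(n−1)(2c(2n−1) − 3n(n−1))` (Faulhaber). [folklore] [cite: Balaban1985Averaging, (125) p.36] -/
theorem twelve_mul_sum_sq_mul_sub (c : ℝ) :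
    ∀ n : ℕ, 12 * ∑ k ∈ Finset.range n, (k : ℝ) ^ 2 * (c - k) = n * ((n : ℝ) - 1) * (2 * c * (2 * n - 1) - 3 * n * ((n : ℝ) - 1))
  | 0 => by simp
  | n + 1 => by
    rw [Finset.sum_range_succ, mul_add, twelve_mul_sum_sq_mul_sub c n]
    push_cast
    ring

/-- `60·Σ_{k<n} k³(c−k) = n(n−1)(15c·n(n−1) − 2(2n−1)(3n²−3n−1))` (Faulhaber). [folklore] [cite: Balaban1985Averaging, (125) p.36] -/
theorem sixty_mul_sum_cube_mul_sub (c : ℝ) :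
    ∀ n : ℕ, 60 * ∑ k ∈ Finset.range n, (k : ℝ) ^ 3 * (c - k) =
      n * ((n : ℝ) - 1) * (15 * c * n * ((n : ℝ) - 1) - 2 * (2 * n - 1) * (3 * (n : ℝ) ^ 2 - 3 * n - 1))
  | 0 => by simp
  | n + 1 => by
    rw [Finset.sum_range_succ, mul_add, sixty_mul_sum_cube_mul_sub c n]
    push_cast
    ring

/-- **`Σ_{k<L} k²(L−1−k) = L(L−1)²(L−2)∕12`** — the profile's block sum along its coordinate. [folklore] [cite: Balaban1985Averaging, (125) p.36] -/
theorem sum_qprof_eq (L : ℕ) :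
    ∑ k ∈ Finset.range L, (k : ℝ) ^ 2 * ((L : ℝ) - 1 - k) = L * ((L : ℝ) - 1) ^ 2 * ((L : ℝ) - 2) / 12 := by
  have h := twelve_mul_sum_sq_mul_sub ((L : ℝ) - 1) L
  have h' : (L : ℝ) * ((L : ℝ) - 1) * (2 * ((L : ℝ) - 1) * (2 * L - 1) - 3 * L * ((L : ℝ) - 1)) = L * ((L : ℝ) - 1) ^ 2 * ((L : ℝ) - 2) := by ring
  rw [h'] at h
  linarith

/-- **THE MARGIN, EXACTLY: `60·Σ_{k<L} (2k+2−L)·k²(L−1−k) = L(L−1)²(L−2)² + 2L(L−1)(L−2)(3L−5)`.** [folklore] [cite: Balaban1985Averaging, (125) p.36] -/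
theorem sixty_mul_sum_skew_qprof_eq (L : ℕ) :
    60 * ∑ k ∈ Finset.range L, (2 * (k : ℝ) + 2 - L) * ((k : ℝ) ^ 2 * ((L : ℝ) - 1 - k)) =
      L * ((L : ℝ) - 1) ^ 2 * ((L : ℝ) - 2) ^ 2 + 2 * L * ((L : ℝ) - 1) * ((L : ℝ) - 2) * (3 * L - 5) := by
  have h1 := twelve_mul_sum_sq_mul_sub ((L : ℝ) - 1) L
  have h2 := sixty_mul_sum_cube_mul_sub ((L : ℝ) - 1) L
  have e : ∑ k ∈ Finset.range L, (2 * (k : ℝ) + 2 - L) * ((k : ℝ) ^ 2 * ((L : ℝ) - 1 - k)) =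
      2 * ∑ k ∈ Finset.range L, (k : ℝ) ^ 3 * (((L : ℝ) - 1) - k) + (2 - (L : ℝ)) * ∑ k ∈ Finset.range L, (k : ℝ) ^ 2 * (((L : ℝ) - 1) - k) := by
    rw [Finset.mul_sum, Finset.mul_sum, ← Finset.sum_add_distrib]
    exact Finset.sum_congr rfl fun k _ => by ring
  rw [e]
  linear_combination 2 * h2 + 5 * (2 - (L : ℝ)) * h1

/-- **`Σ_{k<L} (2k+2−L)·k²(L−1−k) ≥ L(L−1)²(L−2)²∕60`** — the `(k+1)`-weighted sum of the profile beats the `(L−1−k)`-weighted one by a margin of the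
order `L⁵` of either. [folklore] [cite: Balaban1985Averaging, (125) p.36; Balaban1985BackgroundPropagators, Thm 3.11 p.416] -/
theorem sum_skew_qprof_ge {L : ℕ} (hL : 2 ≤ L) :
    L * ((L : ℝ) - 1) ^ 2 * ((L : ℝ) - 2) ^ 2 / 60 ≤ ∑ k ∈ Finset.range L, (2 * (k : ℝ) + 2 - L) * ((k : ℝ) ^ 2 * ((L : ℝ) - 1 - k)) := by
  have h := sixty_mul_sum_skew_qprof_eq L
  have h2 : (2 : ℝ) ≤ L := by exact_mod_cast hL
  have hnn : 0 ≤ 2 * L * ((L : ℝ) - 1) * ((L : ℝ) - 2) * (3 * L - 5) := by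
    have : (0 : ℝ) ≤ L := by linarith
    have : (0 : ℝ) ≤ (L : ℝ) - 1 := by linarith
    have : (0 : ℝ) ≤ (L : ℝ) - 2 := by linarith
    have : (0 : ℝ) ≤ 3 * (L : ℝ) - 5 := by linarith
    positivity
  rw [div_le_iff₀ (by norm_num : (0 : ℝ) < 60)]
  linarith

/-- `Σ(k+1)q(k) + Σ(L−1−k)q(k) = L·Σq(k)` — the two sweep counts of a fine bond add up to `L`. [folklore] [cite: Balaban1985Averaging, (125) p.36] -/
theorem sum_succ_mul_qprof_add (L : ℕ) (q : ℕ → ℝ) :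
    ∑ k ∈ Finset.range L, ((k : ℝ) + 1) * q k + ∑ k ∈ Finset.range L, ((L : ℝ) - 1 - k) * q k = L * ∑ k ∈ Finset.range L, q k := by
  rw [← Finset.sum_add_distrib, Finset.mul_sum]
  exact Finset.sum_congr rfl fun k _ => by ring

/-- `Σ(k+1)q(k) − Σ(L−1−k)q(k) = Σ(2k+2−L)q(k)`. [folklore] [cite: Balaban1985Averaging, (125) p.36] -/
theorem sum_succ_mul_qprof_sub (L : ℕ) (q : ℕ → ℝ) :
    ∑ k ∈ Finset.range L, ((k : ℝ) + 1) * q k - ∑ k ∈ Finset.range L, ((L : ℝ) - 1 - k) * q k =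
      ∑ k ∈ Finset.range L, (2 * (k : ℝ) + 2 - L) * q k := by
  rw [← Finset.sum_sub_distrib]
  exact Finset.sum_congr rfl fun k _ => by ring

/-! ## §4 Crude power bounds for `3 ≤ L` -/

/-- `(L−1)(L−2) ≥ 2L²∕9` for `L ≥ 3` (private arithmetic helper). [folklore] -/
private theorem sub_one_mul_sub_two_ge {L : ℕ} (hL : 3 ≤ L) : 2 * (L : ℝ) ^ 2 / 9 ≤ ((L : ℝ) - 1) * ((L : ℝ) - 2) := by
  have h3 : (3 : ℝ) ≤ L := by exact_mod_cast hL
  nlinarith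

/-- **`Σ_{k<L} k(L−1−k) ≥ L³∕27`** for `L ≥ 3` (ne9-leaf-01's transverse profile; `sum_profile_eq`). [folklore] [cite: Balaban1984PropagatorsII, (2.74)–(2.77) p.236] -/
theorem sum_profile_ge {L : ℕ} (hL : 3 ≤ L) : (L : ℝ) ^ 3 / 27 ≤ ∑ k ∈ Finset.range L, (k : ℝ) * ((L : ℝ) - 1 - k) := by
  rw [sum_profile_eq]
  have h3 : (3 : ℝ) ≤ L := by exact_mod_cast hL
  have h := sub_one_mul_sub_two_ge hL
  have hL0 : (0 : ℝ) ≤ L := by linarith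
  have : (L : ℝ) ^ 3 / 27 = L * (2 * (L : ℝ) ^ 2 / 9) / 6 := by ring
  rw [this]
  have : L * (2 * (L : ℝ) ^ 2 / 9) ≤ L * (((L : ℝ) - 1) * ((L : ℝ) - 2)) := mul_le_mul_of_nonneg_left h hL0
  linarith

/-- `Σ_{k<L} k(L−1−k) ≤ L³∕6` (ne9-leaf-01's transverse profile; `sum_profile_eq`). [folklore] [cite: Balaban1984PropagatorsII, (2.74)–(2.77) p.236] -/
theorem sum_profile_le (L : ℕ) : ∑ k ∈ Finset.range L, (k : ℝ) * ((L : ℝ) - 1 - k) ≤ (L : ℝ) ^ 3 / 6 := by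
  rw [sum_profile_eq]
  have hL0 : (0 : ℝ) ≤ L := Nat.cast_nonneg L
  rw [div_le_div_iff_of_pos_right (by norm_num : (0:ℝ) < 6)]
  rcases le_or_gt 2 (L : ℝ) with h2 | h2
  · have h : ((L : ℝ) - 1) * ((L : ℝ) - 2) ≤ (L : ℝ) * L := by nlinarith
    calc (L : ℝ) * ((L : ℝ) - 1) * ((L : ℝ) - 2) = L * (((L : ℝ) - 1) * ((L : ℝ) - 2)) := by ring
      _ ≤ L * ((L : ℝ) * L) := mul_le_mul_of_nonneg_left h hL0
      _ = (L : ℝ) ^ 3 := by ring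
  · rcases le_or_gt 1 (L : ℝ) with h1 | h1
    · have : (L : ℝ) * ((L : ℝ) - 1) * ((L : ℝ) - 2) ≤ 0 :=
        mul_nonpos_of_nonneg_of_nonpos (mul_nonneg hL0 (by linarith)) (by linarith)
      linarith [pow_nonneg hL0 3]
    · have hL1 : L < 1 := by exact_mod_cast h1
      have hL : L = 0 := by omega
      subst hL; simp

/-- `Σ_{k<L} k²(L−1−k) ≤ L⁴∕12`. [folklore] [cite: Balaban1985Averaging, (125) p.36] -/
theorem sum_qprof_le {L : ℕ} (hL : 1 ≤ L) : ∑ k ∈ Finset.range L, (k : ℝ) ^ 2 * ((L : ℝ) - 1 - k) ≤ (L : ℝ) ^ 4 / 12 := by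
  rw [sum_qprof_eq]
  have h1 : (1 : ℝ) ≤ L := by exact_mod_cast hL
  have hL0 : (0 : ℝ) ≤ L := by linarith
  have ha : ((L : ℝ) - 1) ^ 2 ≤ (L : ℝ) ^ 2 := pow_le_pow_left₀ (by linarith) (by linarith) 2
  have hb : (L : ℝ) - 2 ≤ L := by linarith
  rw [div_le_div_iff_of_pos_right (by norm_num : (0:ℝ) < 12)]
  rcases le_or_gt 2 (L : ℝ) with h2 | h2
  · calc (L : ℝ) * ((L : ℝ) - 1) ^ 2 * ((L : ℝ) - 2) ≤ L * (L : ℝ) ^ 2 * L := by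
          exact mul_le_mul (mul_le_mul_of_nonneg_left ha hL0) hb (by linarith) (by positivity)
      _ = (L : ℝ) ^ 4 := by ring
  · have : (L : ℝ) * ((L : ℝ) - 1) ^ 2 * ((L : ℝ) - 2) ≤ 0 :=
      mul_nonpos_of_nonneg_of_nonpos (by positivity) (by linarith)
    linarith [pow_nonneg hL0 4]

/-- **`Σ_{k<L} (2k+2−L)·k²(L−1−k) ≥ L⁵∕1215`** for `L ≥ 3` — the margin is of the full order `L⁵`. [folklore]
[cite: Balaban1985Averaging, (125) p.36; Balaban1985BackgroundPropagators, Thm 3.11 p.416] -/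
theorem sum_skew_qprof_ge_pow {L : ℕ} (hL : 3 ≤ L) :
    (L : ℝ) ^ 5 / 1215 ≤ ∑ k ∈ Finset.range L, (2 * (k : ℝ) + 2 - L) * ((k : ℝ) ^ 2 * ((L : ℝ) - 1 - k)) := by
  refine le_trans ?_ (sum_skew_qprof_ge (by omega))
  have h3 : (3 : ℝ) ≤ L := by exact_mod_cast hL
  have hL0 : (0 : ℝ) ≤ L := by linarith
  have h := sub_one_mul_sub_two_ge hL
  have h0 : 0 ≤ 2 * (L : ℝ) ^ 2 / 9 := by positivity
  have hsq : (2 * (L : ℝ) ^ 2 / 9) ^ 2 ≤ (((L : ℝ) - 1) * ((L : ℝ) - 2)) ^ 2 := pow_le_pow_left₀ h0 h 2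
  have e : (L : ℝ) ^ 5 / 1215 = L * (2 * (L : ℝ) ^ 2 / 9) ^ 2 / 60 := by ring
  rw [e, div_le_div_iff_of_pos_right (by norm_num : (0:ℝ) < 60)]
  calc (L : ℝ) * (2 * (L : ℝ) ^ 2 / 9) ^ 2 ≤ L * (((L : ℝ) - 1) * ((L : ℝ) - 2)) ^ 2 := mul_le_mul_of_nonneg_left hsq hL0
    _ = L * ((L : ℝ) - 1) ^ 2 * ((L : ℝ) - 2) ^ 2 := by ring

end Literature.MathematicalPhysics.QuantumFieldTheory.Balaban1983to89.B9Eq3126BondTentProfile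

end
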